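import Literature.Computability.AlgebraicComplexity.KV20EvaluationMatrixFP
import Literature.Computability.AlgebraicComplexity.KV20Cor13OfPSPACEEquations
import Literature.Computability.Complexity.CanonicalCodes
import Literature.Computability.Complexity.PSpaceClosure
import Literature.Computability.Complexity.SpaceTMSATHard
import Literature.Computability.Complexity.LengthCompare
import Literature.Computability.Complexity.CodeFPLists
import Literature.Computability.Complexity.CodeFPStrings
import HarnessLib

/-!
# Kumar–Volk Cor. 1.3, machine (P4q): the coefficient QUERIES of `Q_n` in normal form, on codes

Part 3 of the `(P4)-machine` brick of the val-lit KV20 M1 programme (part 1: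
`KV20UniversalMapIntEvaluatorFP`, exact evaluation of `Ũ`; part 2: `KV20EvaluationMatrixFP`, the
entries `kvEntry n r c` of the evaluation matrix `A = evalMat (uFinFlat n) (n³) (kvGridBound n)` in
`FP`). The single hypothesis left open by `KumarVolk2020.cor_1_3_of_canonicalBits` is
`coeffBitLanguage kvCanonicalFamily ∈ PSPACE`: the bit/sign queries `(m, e, j, s)`
(`coeffQueryEncoding`: `m` binary, `e : List ℕ` the exponent vector, `j` a bit position, `s` the
query kind) about the coefficients of the explicit family `Q = kvCanonicalFamily`. This file does the
KV20-SPECIFIC half of that membership proof, leaving to the generic succinct-linear-algebra circuit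
(programme files (P6) A–D, `Complexity/SuccinctCircuitNames.lean` …) exactly one job: answer bit/sign
queries about the ℕ-indexed kernel-vector entries `kvKernelEntry n c` on the codes `⟨1ⁿ, ⟨c, ⟨j, s⟩⟩⟩`.

* §1 (normal form). `kvGram n = AᵀA` (`kvGram_apply`: its entries are the sums
  `Σ_r kvEntry n r c · kvEntry n r c'` of part 2's `FP` entries), `kvKernelEntry n c` (entry `c` of
  `charpolyKernelVector (kvGram n)`, `0` off range), `kvColumn n e = Σ_{i<n²} e_i (n³+1)^i` (the column
  index of an exponent list), `kvQueryOK n e` (all `e_i ≤ n³`, `i < n²`), and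
  ★ `coeffOfList_kvCanonicalFamily_normalForm`: `coeffOfList kvCanonicalFamily m e` is
  `kvKernelEntry n (kvColumn n e)` when `m = n²` and `kvQueryOK n e`, and `0` otherwise — the
  tree's `coeff_kvCanonicalEquation` (x5 g6) with Mathlib's `finFunctionFinEquiv` made numeric; at
  `n = 0` every entry is `0` (`kvKernelEntry_zero_left`: the Gram matrix is the `1 × 1` identity, and
  the canonical kernel vector of a matrix with nonzero determinant is `0`; hence also
  `kvCanonicalEquation_zero : kvCanonicalEquation 0 = 0`, `kvCanonicalFamily_zero`).
* §2 (membership). `mem_coeffBitLanguage_kvCanonicalFamily_iff`: a query code is in the language iff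
  `|e| = m = n²`, `1 ≤ n`, `kvQueryOK n e`, and the bit/sign condition `BitSignQuery` holds of
  `kvKernelEntry n (kvColumn n e)`.
* §3 (codes). The canonical re-encoding of `coeffQueryEncoding` is polynomial time
  (`canonQuery_mem_FP`, `decode_eq_some_decQuery`, `decQuery_codeFP`, by the tree's `CanonicalCodes` kit), the normalising map
  `(m, e, j, s) ↦ ⟨1ⁿ, ⟨kvColumn n e, ⟨j, s⟩⟩⟩` (`n = ⌊√|e|⌋`, size driver `|e|`, never the unary of
  the binary `m`) and the validity test are `CodeFP` (`kvColumnFP`, `kvQueryOKFP`, `queryOutFP`).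
* §4 (packaging). ★ `coeffBitLanguage_kvCanonicalFamily_karpReducible`: for ANY language `L` that
  answers the kernel-entry queries correctly on `1 ≤ n`, `c < (n³+1)^{n²}`
  (`KernelEntryOracle L`), `coeffBitLanguage kvCanonicalFamily ≤ₚ L`; hence
  ★ `coeffBitLanguage_kvCanonicalFamily_mem_PSPACE_of`: such an `L ∈ PSPACE` gives
  `coeffBitLanguage kvCanonicalFamily ∈ PSPACE` (`mem_PSPACE_of_karpReducible'`), i.e. the `hbits`
  of `cor_1_3_of_canonicalBits`, and ★ `kumarVolk2020_cor_1_3_of_kernelEntryOracle`: Cor. 1.3 by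
  name from a kernel-entry oracle in `PSPACE` (via `kumarVolk2020_cor_1_3_of_canonicalBits`);
  oracle languages `oracleLang P` presented through the total decoder `decOQ` of oracle codes
  (`kernelEntryOracle_oracleLang`, `codeFP_decOQ_n/c/j/s`), and the ℕ-valued form of the queries
  `bitSignQuery_natCast_sub_iff` (one `<` test and the bits of two truncated differences).

No new named fact; theorems and bodied definitions only (D-0026); `kumarVolk2020_cor_1_3` stays OPEN by
name (its hypothesis is reduced, not discharged). HONEST FRAMING: Boolean bookkeeping for the
machine side of a published CONDITIONAL result; nothing here bears on `VP ≠ VNP`, which is NOT proved.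

## References

* [KumarVolk2022] M. Kumar, B. L. Volk, *A polynomial degree bound on equations for non-rigid
  matrices and small linear circuits*, ACM TOCT 14(2) (2022) = arXiv:2003.12938; Cor. 1.3 and its
  proof, §6 ("there exists a fixed PSPACE algorithm which, on input 1ⁿ, outputs the list of
  coefficients of the polynomial Q_n"; "solving a linear system … small space algorithm for linear
  algebra [BvzGH82, ABO99]").
* [BorodinVonzurgathenHopcroft1982] A. Borodin, J. von zur Gathen, J. Hopcroft, *Fast parallel matrix
  and GCD computations*, Inform. and Control 52 (1982), §4–§5 (via
  `Literature.LinearAlgebra.KernelVectorViaCharpoly`).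
* [AroraBarak2009] S. Arora, B. Barak, *Computational Complexity: A Modern Approach*, CUP 2009,
  §1.2–1.3 (polynomial-time computable functions, representation independence), §2.1 Def. 2.7 (Karp
  reductions), §4.2 (PSPACE closed under reductions).
-/

noncomputable section

namespace Literature.Computability.AlgebraicComplexity

namespace KumarVolk2020

namespace UEval

open MvPolynomial Matrix Finset Literature.LinearAlgebra Literature.Computability.Complexity
  _root_.Computability

/-! ### §1. The ℕ-indexed normal form of the coefficient queries -/

section NormalForm

/-- **The Gram matrix `B = AᵀA`** of the evaluation matrix `A = evalMat (uFinFlat n) (n³) (kvGridBound n)`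
(the square system the canonical equation solves). [cite: KumarVolk2022, §6 (proof of Cor. 1.3, "solving a linear system of equations")] -/
def kvGram (n : ℕ) : Matrix (Fin ((n ^ 3 + 1) ^ (n * n))) (Fin ((n ^ 3 + 1) ^ (n * n))) ℤ :=
  (evalMat (uFinFlat n) (n ^ 3) (kvGridBound n))ᵀ * evalMat (uFinFlat n) (n ^ 3) (kvGridBound n)

/-- **The kernel-vector entry function on bare indices**: entry `c` of the canonical kernel vector
`charpolyKernelVector (kvGram n)`, and `0` off the column range `c < (n³+1)^{n²}`.
[cite: KumarVolk2022, §6 (proof of Cor. 1.3, "outputs the list of coefficients of the polynomial Q_n")] -/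
def kvKernelEntry (n c : ℕ) : ℤ :=
  if h : c < (n ^ 3 + 1) ^ (n * n) then charpolyKernelVector (kvGram n) ⟨c, h⟩ else 0

/-- **The column index of an exponent list**: `Σ_{i < n²} e_i · (n³+1)^i` (`e_i = e.getD i 0`), the
number Mathlib's `finFunctionFinEquiv` assigns to the digit vector `(e_i)_{i<n²}`.
[cite: KumarVolk2022, §6 (proof of Cor. 1.3)] -/
def kvColumn (n : ℕ) (e : List ℕ) : ℕ :=
  ((List.range (n * n)).map fun i => e.getD i 0 * (n ^ 3 + 1) ^ i).sum

/-- **Validity of an exponent list**: every digit `e_i`, `i < n²`, is `≤ n³` (the exponent bound of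
the canonical equation). [cite: KumarVolk2022, §6 (proof of Cor. 1.3)] -/
def kvQueryOK (n : ℕ) (e : List ℕ) : Bool :=
  (List.range (n * n)).all fun i => decide (e.getD i 0 ≤ n ^ 3)

/-- The entries of the Gram matrix are the sums `Σ_r A_{rc} A_{rc'}` of part 2's entries `kvEntry`.
[cite: KumarVolk2022, §6 (proof of Cor. 1.3)] -/
theorem kvGram_apply (n : ℕ) (c c' : Fin ((n ^ 3 + 1) ^ (n * n))) :
    kvGram n c c' =
      ∑ r : Fin ((kvGridBound n + 1) ^ (corSize n + corSize n)), kvEntry n r c * kvEntry n r c' := by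
  simp only [kvGram, Matrix.mul_apply, Matrix.transpose_apply, kvEntry_of_lt]

/-- The Gram matrix from the ℕ-indexed entry function of part 2 (the form a consumer holding only
`kvEntry` rewrites with). [cite: KumarVolk2022, §6 (proof of Cor. 1.3)] -/
theorem kvGram_eq_of_kvEntry (n : ℕ) :
    kvGram n =
      (Matrix.of fun (r : Fin ((kvGridBound n + 1) ^ (corSize n + corSize n)))
          (c : Fin ((n ^ 3 + 1) ^ (n * n))) => kvEntry n r c)ᵀ *
        Matrix.of fun (r : Fin ((kvGridBound n + 1) ^ (corSize n + corSize n)))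
          (c : Fin ((n ^ 3 + 1) ^ (n * n))) => kvEntry n r c := by
  ext c c'
  rw [kvGram_apply, Matrix.mul_apply]
  rfl

/-- On the column range `kvKernelEntry` IS the kernel-vector entry. [cite: KumarVolk2022, §6 (proof of Cor. 1.3)] -/
theorem kvKernelEntry_of_lt (n : ℕ) (c : Fin ((n ^ 3 + 1) ^ (n * n))) :
    kvKernelEntry n c = charpolyKernelVector (kvGram n) c := by
  unfold kvKernelEntry
  rw [dif_pos c.isLt]

/-- `kvQueryOK` says `e_i ≤ n³` for all `i < n²`. [cite: KumarVolk2022, §6 (proof of Cor. 1.3)] -/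
theorem kvQueryOK_eq_true_iff (n : ℕ) (e : List ℕ) :
    kvQueryOK n e = true ↔ ∀ i < n * n, e.getD i 0 ≤ n ^ 3 := by
  simp only [kvQueryOK, List.all_eq_true, List.mem_range, decide_eq_true_eq]

/-- `kvColumn` as a `Finset` sum. [cite: KumarVolk2022, §6 (proof of Cor. 1.3)] -/
theorem kvColumn_eq_sum (n : ℕ) (e : List ℕ) :
    kvColumn n e = ∑ i ∈ range (n * n), e.getD i 0 * (n ^ 3 + 1) ^ i :=
  ModArith.sum_map_range _ _

/-- For a valid exponent list, `kvColumn n e` is the value of `finFunctionFinEquiv` at the digit vector.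
[cite: KumarVolk2022, §6 (proof of Cor. 1.3)] -/
theorem val_finFunctionFinEquiv_eq_kvColumn (n : ℕ) (e : List ℕ) (h : ∀ i < n * n, e.getD i 0 ≤ n ^ 3) :
    ((finFunctionFinEquiv fun i : Fin (n * n) =>
        (⟨e.getD i 0, Nat.lt_succ_of_le (h i i.isLt)⟩ : Fin (n ^ 3 + 1))) : ℕ) = kvColumn n e := by
  rw [finFunctionFinEquiv_apply, kvColumn_eq_sum]
  exact Fin.sum_univ_eq_sum_range (fun i => e.getD i 0 * (n ^ 3 + 1) ^ i) (n * n)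

/-- A valid exponent list codes a column: `kvColumn n e < (n³+1)^{n²}`. [cite: KumarVolk2022, §6 (proof of Cor. 1.3)] -/
theorem kvColumn_lt (n : ℕ) (e : List ℕ) (h : ∀ i < n * n, e.getD i 0 ≤ n ^ 3) :
    kvColumn n e < (n ^ 3 + 1) ^ (n * n) := by
  rw [← val_finFunctionFinEquiv_eq_kvColumn n e h]
  exact Fin.isLt _

/-- ★ **The coefficients of `Q_n` in normal form (square case)**: the coefficient of `Q_{n²} = Q_n`
read at the exponent list `e` is the kernel-vector entry at column `kvColumn n e` when `e` is valid,
and `0` otherwise. [cite: KumarVolk2022, §6 (proof of Cor. 1.3, "outputs the list of coefficients of the polynomial Q_n")] -/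
theorem coeffOfList_kvCanonicalFamily_sq_normalForm (n : ℕ) (e : List ℕ) :
    coeffOfList kvCanonicalFamily (n * n) e =
      if kvQueryOK n e then kvKernelEntry n (kvColumn n e) else 0 := by
  rw [KumarVolk2020.coeffOfList_kvCanonicalFamily_sq, coeff_kvCanonicalEquation]
  by_cases h : ∀ i < n * n, e.getD i 0 ≤ n ^ 3
  · have h' : ∀ i : Fin (n * n),
        (Finsupp.equivFunOnFinite.symm fun i : Fin (n * n) => e.getD i.1 0) i ≤ n ^ 3 := fun i => by
      rw [Finsupp.coe_equivFunOnFinite_symm]; exact h i i.isLt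
    rw [dif_pos h', (kvQueryOK_eq_true_iff n e).2 h, if_pos rfl, kvKernelEntry,
      dif_pos (kvColumn_lt n e h), kvGram]
    congr 1
    apply Fin.ext
    show _ = kvColumn n e
    rw [← val_finFunctionFinEquiv_eq_kvColumn n e h]
    congr 2
  · have h' : ¬ ∀ i : Fin (n * n),
        (Finsupp.equivFunOnFinite.symm fun i : Fin (n * n) => e.getD i.1 0) i ≤ n ^ 3 := fun h' =>
      h fun i hi => by simpa [Finsupp.coe_equivFunOnFinite_symm] using h' ⟨i, hi⟩
    have hOK : kvQueryOK n e = false := by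
      rw [← Bool.not_eq_true, kvQueryOK_eq_true_iff]; exact h
    rw [dif_neg h', hOK]
    rfl

/-- ★ **The coefficients of the family in normal form**: with `n = ⌊√m⌋`,
`coeffOfList kvCanonicalFamily m e = kvKernelEntry n (kvColumn n e)` when `m = n²` and `e` is valid,
`0` otherwise. [cite: KumarVolk2022, §6 (proof of Cor. 1.3)] -/
theorem coeffOfList_kvCanonicalFamily_normalForm (m : ℕ) (e : List ℕ) :
    coeffOfList kvCanonicalFamily m e =
      if Nat.sqrt m * Nat.sqrt m = m ∧ kvQueryOK (Nat.sqrt m) e = true then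
        kvKernelEntry (Nat.sqrt m) (kvColumn (Nat.sqrt m) e) else 0 := by
  by_cases hsq : Nat.sqrt m * Nat.sqrt m = m
  · conv_lhs => rw [← hsq]
    rw [coeffOfList_kvCanonicalFamily_sq_normalForm]
    by_cases hOK : kvQueryOK (Nat.sqrt m) e = true
    · rw [if_pos hOK, if_pos ⟨hsq, hOK⟩]
    · rw [if_neg hOK, if_neg fun h => hOK h.2]
  · rw [KumarVolk2020.coeffOfList_kvCanonicalFamily_of_not_sq hsq, if_neg fun h => hsq h.1]

/-! #### The degenerate size `n = 0`: every kernel entry is `0` -/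

/-- The canonical kernel vector of a matrix with NONZERO determinant is `0` (`k_B = 0`, so `j₀ = 0`,
`q_B(B) = 0`, `N_B = 0`). [cite: BorodinVonzurgathenHopcroft1982, §4–§5 (p0012:L46–66, p0026:L36–37)] -/
private theorem charpolyKernelVector_eq_zero_of_det_ne_zero {ι : Type} [Fintype ι] [DecidableEq ι]
    [LinearOrder ι] (B : Matrix ι ι ℤ) (hB : B.det ≠ 0) : charpolyKernelVector B = 0 := by
  have hk : charpolyZeroMult B = 0 := by
    by_contra hk
    have h0 : B.charpoly.coeff 0 = 0 := coeff_charpoly_eq_zero_of_lt B (Nat.pos_of_ne_zero hk)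
    have hdet := Matrix.det_eq_sign_charpoly_coeff B
    rw [h0, mul_zero] at hdet
    exact hB hdet
  have hj : charpolyNilIndex B = 0 := Nat.eq_zero_of_le_zero (hk ▸ charpolyNilIndex_le B)
  have hq : Polynomial.aeval B (charpolyUnitPart B) = 0 := by
    have h := charpolyNilIndex_spec B
    rwa [hj, pow_zero, mul_one] at h
  have hN : charpolyKernelMatrix B = 0 := by
    show Polynomial.aeval B (charpolyUnitPart B) * B ^ (charpolyNilIndex B - 1) = 0
    rw [hq, zero_mul]
  rcases charpolyKernelVector_eq_col_or_zero B with ⟨c, hc⟩ | h0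
  · rw [hc, hN, Matrix.transpose_zero]; rfl
  · exact h0

/-- At `n = 0` the evaluation matrix is the `1 × 1` matrix `(1)` (empty product over `Fin 0`
variables, one grid point, one exponent vector). [cite: KumarVolk2022, §6 (proof of Cor. 1.3)] -/
theorem kvEntry_zero_left (r : Fin ((kvGridBound 0 + 1) ^ (corSize 0 + corSize 0)))
    (c : Fin ((0 ^ 3 + 1) ^ (0 * 0))) : kvEntry 0 r c = 1 := by
  rw [kvEntry_eq, if_pos ⟨r.isLt, c.isLt⟩]
  simp [entryN]

/-- At `n = 0` the Gram matrix is the identity. [cite: KumarVolk2022, §6 (proof of Cor. 1.3)] -/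
theorem kvGram_zero : kvGram 0 = 1 := by
  have h1 : (0 ^ 3 + 1) ^ (0 * 0) = 1 := by norm_num
  have hR : (kvGridBound 0 + 1) ^ (corSize 0 + corSize 0) = 1 := by simp [corSize]
  ext c c'
  have hcc : c = c' := Fin.ext (by have := c.isLt; have := c'.isLt; omega)
  subst hcc
  rw [kvGram_apply, Matrix.one_apply_eq]
  simp only [kvEntry_zero_left, mul_one, Finset.sum_const, Finset.card_univ, Fintype.card_fin,
    hR, one_nsmul]

/-- ★ At `n = 0` every kernel entry is `0` (so no coefficient query with `m = 0` is in the language).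
[cite: KumarVolk2022, §6 (proof of Cor. 1.3)] -/
theorem kvKernelEntry_zero_left (c : ℕ) : kvKernelEntry 0 c = 0 := by
  unfold kvKernelEntry
  split_ifs with h
  · rw [charpolyKernelVector_eq_zero_of_det_ne_zero (kvGram 0) (by rw [kvGram_zero, det_one]; exact one_ne_zero)]
    rfl
  · rfl

/-- ★ **`Q_0 = 0`**: at `n = 0` the canonical equation is the zero polynomial (its coefficient
vector is the canonical kernel vector of the identity, which is `0`) — the degenerate case a circuit
with `2 ≤ N` cannot see. [cite: KumarVolk2022, §6 (proof of Cor. 1.3)] -/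
theorem kvCanonicalEquation_zero : kvCanonicalEquation 0 = 0 := by
  show polyOfVec _ _ (charpolyKernelVector (kvGram 0)) = 0
  rw [polyOfVec_eq_zero_iff]
  exact charpolyKernelVector_eq_zero_of_det_ne_zero _ (by rw [kvGram_zero, det_one]; exact one_ne_zero)

/-- Hence `Q_m = 0` for `m = 0` as a member of the family, and no coefficient query with `m = 0` holds.
[cite: KumarVolk2022, §6 (proof of Cor. 1.3)] -/
theorem kvCanonicalFamily_zero : kvCanonicalFamily 0 = 0 := by
  have h : kvCanonicalFamily (0 * 0) = kvCanonicalEquation 0 := kvCanonicalFamily_sq 0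
  rw [kvCanonicalEquation_zero] at h
  exact h

end NormalForm

/-! ### §2. Membership in the coefficient bit language, in normal form -/

section Membership

/-- **The bit/sign condition of a query** `(j, s)` on an integer `v`: kind `s = 0` asks bit `j` of
`|v|`, kind `s = 1` asks `v < 0` (the two clauses of `coeffBitLanguage`). [cite: KumarVolk2022, Cor. 1.3 (item 1)] -/
def BitSignQuery (v : ℤ) (j s : ℕ) : Prop :=
  (s = 0 ∧ v.natAbs.testBit j = true) ∨ (s = 1 ∧ v < 0)

/-- **Bit/sign queries on a difference of naturals** (the form a circuit with ℕ-valued designated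
gates `V⁺, V⁻` answers: one `<` test and the bits of the two truncated differences, of which at most
one is nonzero). [cite: KumarVolk2022, §6 (proof of Cor. 1.3)] -/
theorem bitSignQuery_natCast_sub_iff (a b j s : ℕ) :
    BitSignQuery ((a : ℤ) - b) j s ↔
      (s = 0 ∧ ((a - b).testBit j || (b - a).testBit j) = true) ∨ (s = 1 ∧ a < b) := by
  have habs : ((a : ℤ) - b).natAbs = (a - b) + (b - a) := by omega
  have hlt : (a : ℤ) - b < 0 ↔ a < b := by omega
  unfold BitSignQuery
  rw [habs, hlt]
  rcases le_total a b with h | h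
  · rw [Nat.sub_eq_zero_of_le h, zero_add, Nat.zero_testBit, Bool.false_or]
  · rw [Nat.sub_eq_zero_of_le h, add_zero, Nat.zero_testBit, Bool.or_false]

/-- No query holds of `v = 0`. [folklore] -/
private theorem not_bitSignQuery_zero (j s : ℕ) : ¬ BitSignQuery 0 j s := by
  rintro (⟨-, h⟩ | ⟨-, h⟩)
  · simp at h
  · exact lt_irrefl _ h

/-- The defining condition of `coeffBitLanguage Q` at a decoded query, restated through `BitSignQuery`.
[cite: KumarVolk2022, Cor. 1.3 (item 1)] -/
theorem mem_coeffBitLanguage_iff (Q : ∀ k, MvPolynomial (Fin k) ℤ) (q : ℕ × List ℕ × ℕ × ℕ) :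
    coeffQueryEncoding.encode q ∈ coeffBitLanguage Q ↔
      q.2.1.length = q.1 ∧ BitSignQuery (coeffOfList Q q.1 q.2.1) q.2.2.1 q.2.2.2 := by
  unfold coeffBitLanguage
  rw [Encoding.mem_toLanguage_iff]
  rfl

/-- ★ **Membership in normal form**: a query `(m, e, j, s)` is in `coeffBitLanguage kvCanonicalFamily`
iff `|e| = m = n²` with `n = ⌊√m⌋ ≥ 1`, `e` is valid, and the bit/sign condition holds of the kernel
entry at column `kvColumn n e`. [cite: KumarVolk2022, Cor. 1.3 (item 1) and §6 (proof)] -/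
theorem mem_coeffBitLanguage_kvCanonicalFamily_iff (q : ℕ × List ℕ × ℕ × ℕ) :
    coeffQueryEncoding.encode q ∈ coeffBitLanguage kvCanonicalFamily ↔
      q.2.1.length = q.1 ∧ Nat.sqrt q.1 * Nat.sqrt q.1 = q.1 ∧ 1 ≤ Nat.sqrt q.1 ∧
        kvQueryOK (Nat.sqrt q.1) q.2.1 = true ∧
          BitSignQuery (kvKernelEntry (Nat.sqrt q.1) (kvColumn (Nat.sqrt q.1) q.2.1)) q.2.2.1 q.2.2.2 := by
  rw [mem_coeffBitLanguage_iff, coeffOfList_kvCanonicalFamily_normalForm]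
  constructor
  · rintro ⟨hlen, hbs⟩
    by_cases hc : Nat.sqrt q.1 * Nat.sqrt q.1 = q.1 ∧ kvQueryOK (Nat.sqrt q.1) q.2.1 = true
    · rw [if_pos hc] at hbs
      refine ⟨hlen, hc.1, ?_, hc.2, hbs⟩
      rcases Nat.eq_zero_or_pos (Nat.sqrt q.1) with h0 | hpos
      · rw [h0, kvKernelEntry_zero_left] at hbs
        exact (not_bitSignQuery_zero _ _ hbs).elim
      · exact hpos
    · rw [if_neg hc] at hbs
      exact (not_bitSignQuery_zero _ _ hbs).elim
  · rintro ⟨hlen, hsq, -, hOK, hbs⟩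
    exact ⟨hlen, by rwa [if_pos ⟨hsq, hOK⟩]⟩

end Membership

/-! ### §3. Codes: the canonical decoder of the query code and the normalising map -/

section Codes

open Literature.Computability.Complexity.CodeFP Brick CanonCode

/-- The query type `(m, e, j, s)`. [cite: KumarVolk2022, Cor. 1.3 (item 1)] -/
abbrev CoeffQuery : Type := ℕ × List ℕ × ℕ × ℕ

/-- The query code as a `CodeFP` encoder: `⟨m, ⟨e, ⟨j, s⟩⟩⟩` with `m, j, s` binary and `e` a headed
list of binary numerals (= `coeffQueryEncoding.encode`, `encode_coeffQuery_eq`). [cite: KumarVolk2022, Cor. 1.3 (item 1)] -/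
abbrev qE : CoeffQuery → List Bool := pairE natE (pairE (listE natE) (pairE natE natE))

/-- The ORACLE query code `⟨1ⁿ, ⟨c, ⟨j, s⟩⟩⟩` (`n` unary; `c, j, s` binary): the questions the generic
kernel-vector circuit is asked. [cite: KumarVolk2022, §6 (proof of Cor. 1.3)] -/
abbrev oqE : ℕ × ℕ × ℕ × ℕ → List Bool := pairE unE (pairE natE (pairE natE natE))

/-- `coeffQueryEncoding` codes by `qE`. [cite: AroraBarak2009, §1.2 (representations of tuples and lists)] -/
theorem encode_coeffQuery_eq : (coeffQueryEncoding.encode : CoeffQuery → List Bool) = qE := by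
  simp only [coeffQueryEncoding, pairE_eq, listE_eq, natE_eq]

/-- **The total decoder of query codes** (Mathlib's `decodeNat` on the numeral parts, the counted
list decoder `NegCNF.decList` on the list part): the value of `coeffQueryEncoding.decode` on EVERY
string (`decode_eq_some_decQuery`). [cite: AroraBarak2009, §1.2 (representation independence)] -/
def decQuery (w : List Bool) : CoeffQuery :=
  (decodeNat (boolUnpair w).1,
    NegCNF.decList decodeNat (boolUnpair (boolUnpair (boolUnpair w).2).1).1.length
      (boolUnpair (boolUnpair (boolUnpair w).2).1).2,
    decodeNat (boolUnpair (boolUnpair (boolUnpair w).2).2).1,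
    decodeNat (boolUnpair (boolUnpair (boolUnpair w).2).2).2)

/-- **The canonical re-encoding of query codes** `w ↦ code (decQuery w)`, assembled from the tree's
`CanonicalCodes` kit (`canonF` for numerals, `canonListFn`, `canonPairFn`). [cite: AroraBarak2009, §1.3] -/
def canonQuery : List Bool → List Bool :=
  canonPairFn canonF (canonPairFn (canonListFn canonF) (canonPairFn canonF canonF))

/-- `canonQuery ∈ FP`. [cite: AroraBarak2009, §1.3] -/
theorem canonQuery_mem_FP : canonQuery ∈ FP :=
  canonPairFn_mem_FP canonF_mem_FP (canonPairFn_mem_FP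
    (canonListFn_mem_FP canonF_mem_FP length_canonF_le) (canonPairFn_mem_FP canonF_mem_FP canonF_mem_FP))

/-- **`decQuery` is the decoder and `canonQuery` re-encodes it.** [cite: AroraBarak2009, §1.2–1.3] -/
theorem decode_eq_some_decQuery (w : List Bool) :
    coeffQueryEncoding.decode w = some (decQuery w) ∧
      canonQuery w = coeffQueryEncoding.encode (decQuery w) := by
  have hN : ∀ u, encodingNatBool.decode u = some (decodeNat u) := fun _ => rfl
  have hcN : ∀ u, canonF u = encodingNatBool.encode (decodeNat u) := canonF_eq_encodeNat_decodeNat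
  have hP := canonPairFn_eq encodingNatBool encodingNatBool decodeNat decodeNat hN hN hcN hcN
  have hL := canonListFn_eq encodingNatBool decodeNat hN hcN
  have hLP := canonPairFn_eq (encodingNatBool.listBool) (encodingNatBool.pairBool encodingNatBool)
    (fun u => NegCNF.decList decodeNat (boolUnpair u).1.length (boolUnpair u).2)
    (fun u => (decodeNat (boolUnpair u).1, decodeNat (boolUnpair u).2))
    (fun u => (hL u).1) (fun u => (hP u).1) (fun u => (hL u).2) (fun u => (hP u).2)
  exact canonPairFn_eq encodingNatBool (encodingNatBool.listBool.pairBool (encodingNatBool.pairBool encodingNatBool))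
    decodeNat _ hN (fun u => (hLP u).1) hcN (fun u => (hLP u).2) w

/-- `decQuery` inverts the encoding. [cite: AroraBarak2009, §1.2] -/
theorem decQuery_encode (q : CoeffQuery) : decQuery (coeffQueryEncoding.encode q) = q := by
  have h := (decode_eq_some_decQuery (coeffQueryEncoding.encode q)).1
  rw [coeffQueryEncoding.decode_encode] at h
  exact (Option.some_injective _ h).symm

/-- **The re-encoding `w ↦ code (decQuery w)` is polynomial time.** [cite: AroraBarak2009, §1.3] -/
theorem decQuery_codeFP : CodeFP strE coeffQueryEncoding.encode decQuery :=
  CodeFP.of_fn canonQuery canonQuery_mem_FP fun w => (decode_eq_some_decQuery w).2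

/-- **Validity of a query**, computed from the list: `|e| = m`, `|e| = n²` for `n = ⌊√|e|⌋ ≥ 1`, and
all digits `≤ n³`. [cite: KumarVolk2022, §6 (proof of Cor. 1.3)] -/
def queryGood (q : CoeffQuery) : Bool :=
  decide (q.2.1.length = q.1) &&
    (decide (Nat.sqrt q.2.1.length * Nat.sqrt q.2.1.length = q.2.1.length) &&
      (decide (1 ≤ Nat.sqrt q.2.1.length) && kvQueryOK (Nat.sqrt q.2.1.length) q.2.1))

/-- The rejected word: the oracle query `⟨1, ⟨0, ⟨0, 2⟩⟩⟩` (kind `2` is neither a bit nor a sign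
query). [folklore] -/
def badQuery : List Bool := oqE (1, 0, 0, 2)

/-- **The normalising map**: a good query goes to the oracle query `⟨1ⁿ, ⟨kvColumn n e, ⟨j, s⟩⟩⟩`,
anything else to `badQuery`. [cite: KumarVolk2022, §6 (proof of Cor. 1.3)] -/
def queryOut (q : CoeffQuery) : List Bool :=
  if queryGood q then
    oqE (Nat.sqrt q.2.1.length, kvColumn (Nat.sqrt q.2.1.length) q.2.1, q.2.2.1, q.2.2.2)
  else badQuery

/-- `kvQueryOK` on codes: context `(e, n)` with `e` raw and `n` binary, plus a unary budget `≥ n²`.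
[cite: AroraBarak2009, §1.3 (bounded loops)] -/
theorem kvQueryOKFP {T : Type} {eT : T → List Bool} {ef : T → List ℕ} {nf Nf : T → ℕ}
    (he : CodeFP eT (rawE natE) ef) (hn : CodeFP eT natE nf) (hN : CodeFP eT unE Nf)
    (hle : ∀ t, nf t * nf t ≤ Nf t) : CodeFP eT bitE (fun t => kvQueryOK (nf t) (ef t)) := by
  have hB : CodeFP eT natE (fun t => nf t ^ 3) := (natPow.comp (hn.pair (const _ (3 : ℕ))) :)
  have hrange : CodeFP eT (rawE natE) (fun t => List.range (nf t * nf t)) :=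
    (rangeOf.comp (hN.pair (natMul.comp (hn.pair hn)))).congr fun t => by
      simp only [min_eq_left (hle t)]
  -- item predicate on `((e, B), i)`
  have hp : CodeFP (pairE (pairE (rawE natE) natE) natE) bitE
      (fun q => decide (q.1.1.getD q.2 0 ≤ q.1.2)) :=
    (natLe.comp (((rawGetOr natE).comp ((fst _ _).fst'.pair ((snd _ _).pair (const _ (0 : ℕ))))).pair
      (fst _ _).snd') :)
  exact ((CodeFP.all hp).comp ((he.pair hB).pair hrange)).congr fun t => rfl

/-- `kvColumn` on codes (same context and budget). [cite: AroraBarak2009, §1.3 (bounded loops)] -/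
theorem kvColumnFP {T : Type} {eT : T → List Bool} {ef : T → List ℕ} {nf Nf : T → ℕ}
    (he : CodeFP eT (rawE natE) ef) (hn : CodeFP eT natE nf) (hN : CodeFP eT unE Nf)
    (hle : ∀ t, nf t * nf t ≤ Nf t) : CodeFP eT natE (fun t => kvColumn (nf t) (ef t)) := by
  have hB1 : CodeFP eT natE (fun t => nf t ^ 3 + 1) :=
    (natAdd.comp ((natPow.comp (hn.pair (const _ (3 : ℕ)))).pair (const _ (1 : ℕ))) :)
  have hrange : CodeFP eT (rawE natE) (fun t => List.range (nf t * nf t)) :=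
    (rangeOf.comp (hN.pair (natMul.comp (hn.pair hn)))).congr fun t => by
      simp only [min_eq_left (hle t)]
  -- item map on `(((e, B1), N), i) ↦ e_i · B1 ^ (min i N)`
  have hg : CodeFP (pairE (pairE (pairE (rawE natE) natE) unE) natE) natE
      (fun q => q.1.1.1.getD q.2 0 * q.1.1.2 ^ min q.2 q.1.2) :=
    (natMul.comp ((((rawGetOr natE).comp ((fst _ _).fst'.fst'.pair ((snd _ _).pair (const _ (0 : ℕ)))))).pair
      (natPow.comp ((fst _ _).fst'.snd'.pair (unOfNatMin.comp ((fst _ _).snd'.pair (snd _ _)))))) :)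
  refine ((natSum.comp ((CodeFP.map hg).comp (((he.pair hB1).pair hN).pair hrange)))).congr fun t => ?_
  simp only [kvColumn]
  congr 1
  refine List.map_congr_left fun i hi => ?_
  rw [min_eq_left ((List.mem_range.1 hi).le.trans (hle t))]

/-- **The normalising map is polynomial time on query codes** (size driver `|e|`; `n = ⌊√|e|⌋` in
unary is at most `|e|`). [cite: AroraBarak2009, §1.3] -/
theorem queryOutFP : CodeFP qE strE queryOut := by
  have hm : CodeFP qE natE (fun q => q.1) := fst _ _
  have heR : CodeFP qE (rawE natE) (fun q => q.2.1) := ((rawOfList natE).comp (snd _ _).fst' :)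
  have hj : CodeFP qE natE (fun q => q.2.2.1) := (snd _ _).snd'.fst'
  have hs : CodeFP qE natE (fun q => q.2.2.2) := (snd _ _).snd'.snd'
  have hL : CodeFP qE natE (fun q => q.2.1.length) := ((natLength natE).comp heR :)
  have hLU : CodeFP qE unE (fun q => q.2.1.length) := ((ulength natE).comp heR :)
  have hn : CodeFP qE natE (fun q => Nat.sqrt q.2.1.length) := (natSqrt.comp hL :)
  have hnU : CodeFP qE unE (fun q => Nat.sqrt q.2.1.length) :=
    (unOfNatMin.comp (hLU.pair hn)).congr fun q => min_eq_left (Nat.sqrt_le_self _)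
  have hle : ∀ q : CoeffQuery, Nat.sqrt q.2.1.length * Nat.sqrt q.2.1.length ≤ q.2.1.length := fun q =>
    Nat.sqrt_le _
  have hOK := kvQueryOKFP heR hn hLU hle
  have hcol := kvColumnFP heR hn hLU hle
  have hgood : CodeFP qE bitE queryGood :=
    ((natEq.comp (hL.pair hm)).and ((natEq.comp ((natMul.comp (hn.pair hn)).pair hL)).and
      ((natLe.comp ((const _ (1 : ℕ)).pair hn)).and hOK))).congr fun q => rfl
  have hcode : CodeFP qE strE (fun q =>
      oqE (Nat.sqrt q.2.1.length, kvColumn (Nat.sqrt q.2.1.length) q.2.1, q.2.2.1, q.2.2.2)) :=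
    ((hnU.pair (hcol.pair (hj.pair hs))).recodeOut (eγ := strE) fun _ => rfl :)
  exact (hgood.ite hcode (const _ badQuery)).congr fun q => rfl

/-- The same map read against `coeffQueryEncoding.encode`. [cite: AroraBarak2009, §1.3 (representation independence)] -/
theorem queryOutFP' : CodeFP coeffQueryEncoding.encode strE queryOut :=
  queryOutFP.comp (CodeFP.recode (eα' := qE) fun q => by rw [encode_coeffQuery_eq])

end Codes

/-! ### §4. Packaging: the coefficient bit language reduces to ANY correct kernel-entry oracle -/

section Packaging

open Literature.Computability.Complexity.CodeFP Brick
open scoped Literature.Computability.Complexity.Notation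

/-- **A kernel-entry oracle**: a language `L` answering, on the oracle codes `⟨1ⁿ, ⟨c, ⟨j, s⟩⟩⟩` with
`1 ≤ n` and `c` in the column range, exactly the bit/sign queries about `kvKernelEntry n c` (what
the generic kernel-vector circuit of the programme provides through its designated gates).
[cite: KumarVolk2022, §6 (proof of Cor. 1.3, "small space algorithm for linear algebra")] -/
def KernelEntryOracle (L : Language Bool) : Prop :=
  ∀ n c j s : ℕ, 1 ≤ n → c < (n ^ 3 + 1) ^ (n * n) →
    (oqE (n, c, j, s) ∈ L ↔ BitSignQuery (kvKernelEntry n c) j s)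

/-- The rejected word is rejected by every oracle. [cite: AroraBarak2009, §2.1 (Def. 2.7: a fixed "no" instance)] -/
theorem badQuery_not_mem {L : Language Bool} (hL : KernelEntryOracle L) : badQuery ∉ L := fun h => by
  rcases (hL 1 0 0 2 le_rfl (by norm_num)).1 h with ⟨h2, -⟩ | ⟨h2, -⟩ <;> omega

/-- `queryGood` unfolded. [cite: KumarVolk2022, §6 (proof of Cor. 1.3)] -/
theorem queryGood_eq_true_iff (q : CoeffQuery) :
    queryGood q = true ↔ q.2.1.length = q.1 ∧
      Nat.sqrt q.2.1.length * Nat.sqrt q.2.1.length = q.2.1.length ∧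
        1 ≤ Nat.sqrt q.2.1.length ∧ kvQueryOK (Nat.sqrt q.2.1.length) q.2.1 = true := by
  simp only [queryGood, Bool.and_eq_true, decide_eq_true_eq]

/-- **The normalising map is a reduction at the level of decoded queries.**
[cite: KumarVolk2022, §6 (proof of Cor. 1.3)] -/
theorem mem_coeffBitLanguage_iff_queryOut_mem {L : Language Bool} (hL : KernelEntryOracle L) (q : CoeffQuery) :
    coeffQueryEncoding.encode q ∈ coeffBitLanguage kvCanonicalFamily ↔ queryOut q ∈ L := by
  rw [mem_coeffBitLanguage_kvCanonicalFamily_iff]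
  constructor
  · rintro ⟨hlen, hsq, hpos, hOK, hbs⟩
    rw [← hlen] at hsq hpos hOK hbs
    have hg : queryGood q = true := (queryGood_eq_true_iff q).2 ⟨hlen, hsq, hpos, hOK⟩
    rw [queryOut, if_pos hg]
    exact (hL _ _ _ _ hpos (kvColumn_lt _ _ ((kvQueryOK_eq_true_iff _ _).1 hOK))).2 hbs
  · intro h
    by_cases hg : queryGood q = true
    · rw [queryOut, if_pos hg] at h
      obtain ⟨hlen, hsq, hpos, hOK⟩ := (queryGood_eq_true_iff q).1 hg
      have hbs := (hL _ _ _ _ hpos (kvColumn_lt _ _ ((kvQueryOK_eq_true_iff _ _).1 hOK))).1 h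
      rw [hlen] at hsq hpos hOK hbs
      exact ⟨hlen, hsq, hpos, hOK, hbs⟩
    · rw [queryOut, if_neg hg] at h
      exact (badQuery_not_mem hL h).elim

/-- ★ **`coeffBitLanguage kvCanonicalFamily ≤ₚ L` for every kernel-entry oracle `L`**: the Karp
reduction "if `w` re-encodes to itself then `queryOut (decQuery w)` else `badQuery`" (the pattern of
the tree's `karpReducible_of_decoder_of_codeFP`, replayed here to keep this file out of the PIT/RP
import cone). [cite: AroraBarak2009, §2.1 (Def. 2.7)] [cite: KumarVolk2022, §6 (proof of Cor. 1.3)] -/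
theorem coeffBitLanguage_kvCanonicalFamily_karpReducible {L : Language Bool} (hL : KernelEntryOracle L) :
    coeffBitLanguage kvCanonicalFamily ≤ₚ L := by
  classical
  have hre : CodeFP strE strE (fun w => coeffQueryEncoding.encode (decQuery w)) :=
    decQuery_codeFP.recodeOut fun _ => rfl
  have htest : CodeFP strE bitE (fun w => decide (coeffQueryEncoding.encode (decQuery w) = w)) :=
    ((CodeFP.eq (eα := strE) fun _ _ h => h).comp (hre.pair (CodeFP.id strE))).congr fun _ => rfl
  have hout : CodeFP strE strE (fun w => queryOut (decQuery w)) := queryOutFP'.comp decQuery_codeFP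
  obtain ⟨f, hf, hfF⟩ := htest.ite hout (CodeFP.const strE (eβ := strE) badQuery)
  refine ⟨f, hf, fun w => ?_⟩
  have hfw : f w = if decide (coeffQueryEncoding.encode (decQuery w) = w) then queryOut (decQuery w)
      else badQuery := hfF w
  show w ∈ coeffBitLanguage kvCanonicalFamily ↔ f w ∈ L
  rw [hfw]
  by_cases hw : coeffQueryEncoding.encode (decQuery w) = w
  · rw [decide_eq_true hw, if_pos rfl, ← mem_coeffBitLanguage_iff_queryOut_mem hL, hw]
  · rw [decide_eq_false hw]
    refine ⟨fun h => ?_, fun h => (badQuery_not_mem hL h).elim⟩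
    obtain ⟨q, -, rfl⟩ := h
    exact (hw (by rw [decQuery_encode])).elim

/-- ★ **A kernel-entry oracle in `PSPACE` puts the coefficient bits of `Q` in `PSPACE`** — the
hypothesis `hbits` of `cor_1_3_of_canonicalBits`. [cite: KumarVolk2022, Cor. 1.3 (proof, §6)] [cite: AroraBarakCC2009, §4.2] -/
theorem coeffBitLanguage_kvCanonicalFamily_mem_PSPACE_of {L : Language Bool} (hL : KernelEntryOracle L)
    (hP : L ∈ PSPACE) : coeffBitLanguage kvCanonicalFamily ∈ PSPACE :=
  mem_PSPACE_of_karpReducible' (coeffBitLanguage_kvCanonicalFamily_karpReducible hL) hP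

/-- ★ **Kumar–Volk Cor. 1.3 from a kernel-entry oracle in `PSPACE`** (the form the programme's
closer applies to the succinct kernel-vector circuit). [cite: KumarVolk2022, Cor. 1.3 (proof, §6)] -/
theorem kumarVolk2020_cor_1_3_of_kernelEntryOracle {L : Language Bool} (hL : KernelEntryOracle L)
    (hP : L ∈ PSPACE) : kumarVolk2020_cor_1_3 :=
  kumarVolk2020_cor_1_3_of_canonicalBits (coeffBitLanguage_kvCanonicalFamily_mem_PSPACE_of hL hP)

/-! #### Oracle languages presented through the total decoder of oracle codes -/

/-- **The total decoder of oracle codes** `⟨1ⁿ, ⟨c, ⟨j, s⟩⟩⟩` (unary length of the first component,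
`bitsToNat` of the three numeral components): a left inverse of `oqE` defined on every string, so
that a language given by a predicate on the decoded tuple is well defined. [cite: AroraBarak2009, §1.2 (representation independence)] -/
def decOQ (w : List Bool) : ℕ × ℕ × ℕ × ℕ :=
  ((fstF w).length, bitsToNat (fstF (sndF w)), bitsToNat (fstF (sndF (sndF w))),
    bitsToNat (sndF (sndF (sndF w))))

/-- `decOQ` inverts `oqE`. [cite: AroraBarak2009, §1.2] -/
theorem decOQ_oqE (q : ℕ × ℕ × ℕ × ℕ) : decOQ (oqE q) = q := by
  obtain ⟨n, c, j, s⟩ := q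
  simp only [decOQ, pairE_apply, fstF_boolPair, sndF_boolPair, bitsToNat_natE, length_unE]

/-- **The oracle language of a predicate** `P n c j s` on decoded oracle queries. [cite: AroraBarak2009, §1.2 (decision problems as languages)] -/
def oracleLang (P : ℕ → ℕ → ℕ → ℕ → Prop) : Language Bool :=
  {w | P (decOQ w).1 (decOQ w).2.1 (decOQ w).2.2.1 (decOQ w).2.2.2}

/-- Membership of an oracle code in `oracleLang P` is `P`. [cite: AroraBarak2009, §1.2] -/
theorem oqE_mem_oracleLang_iff (P : ℕ → ℕ → ℕ → ℕ → Prop) (n c j s : ℕ) :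
    oqE (n, c, j, s) ∈ oracleLang P ↔ P n c j s := by
  show P _ _ _ _ ↔ _
  rw [decOQ_oqE]

/-- **A predicate agreeing with the kernel-entry queries on the range gives a kernel-entry oracle**
(the form the circuit file uses: `P n c j s` := "bit `j` of `val V⁺(n,c) ∸ val V⁻(n,c)` or of
`val V⁻ ∸ val V⁺`" / "`val V⁺ < val V⁻`", cf. `bitSignQuery_natCast_sub_iff`). [cite: KumarVolk2022, §6 (proof of Cor. 1.3)] -/
theorem kernelEntryOracle_oracleLang {P : ℕ → ℕ → ℕ → ℕ → Prop}
    (hP : ∀ n c j s : ℕ, 1 ≤ n → c < (n ^ 3 + 1) ^ (n * n) →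
      (P n c j s ↔ BitSignQuery (kvKernelEntry n c) j s)) :
    KernelEntryOracle (oracleLang P) := fun n c j s hn hc => by
  rw [oqE_mem_oracleLang_iff]; exact hP n c j s hn hc

/-- The first projection of a string pair, as a typed fact. [folklore] -/
private theorem strFstQ : CodeFP strE strE fstF := CodeFP.of_fn fstF fstF_mem_FP fun _ => rfl

/-- The second projection of a string pair, as a typed fact. [folklore] -/
private theorem strSndQ : CodeFP strE strE sndF := CodeFP.of_fn sndF sndF_mem_FP fun _ => rfl

/-- The decoded `n` (unary) is polynomial time on strings. [cite: AroraBarak2009, §1.3] -/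
theorem codeFP_decOQ_n : CodeFP strE unE (fun w => (decOQ w).1) := (strLength.comp strFstQ :)

/-- The decoded column `c` (binary) is polynomial time on strings. [cite: AroraBarak2009, §1.3] -/
theorem codeFP_decOQ_c : CodeFP strE natE (fun w => (decOQ w).2.1) :=
  (strVal.comp (strFstQ.comp strSndQ) :)

/-- The decoded bit position `j` (binary) is polynomial time on strings. [cite: AroraBarak2009, §1.3] -/
theorem codeFP_decOQ_j : CodeFP strE natE (fun w => (decOQ w).2.2.1) :=
  (strVal.comp (strFstQ.comp (strSndQ.comp strSndQ)) :)

/-- The decoded kind `s` (binary) is polynomial time on strings. [cite: AroraBarak2009, §1.3] -/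
theorem codeFP_decOQ_s : CodeFP strE natE (fun w => (decOQ w).2.2.2) :=
  (strVal.comp (strSndQ.comp (strSndQ.comp strSndQ)) :)

/-! #### From three `PSPACE` languages about ℕ-valued designated gates to Cor. 1.3 -/

/-- The kind test `s = k` on oracle codes is a `P` language. [cite: AroraBarak2009, §1.3] -/
private theorem kindEq_mem_P (k : ℕ) : ({w | (decOQ w).2.2.2 = k} : Language Bool) ∈ Classes.P := by
  obtain ⟨G, hG, hGw⟩ :=
    (natEq.comp (codeFP_decOQ_s.pair (CodeFP.const strE (eβ := natE) k)) :
      CodeFP strE bitE fun w => decide ((decOQ w).2.2.2 = k))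
  refine mem_P_of_mem_FP hG _ fun w => ⟨fun hw => ?_, fun hw => ?_⟩
  · rw [show G w = bitE (decide ((decOQ w).2.2.2 = k)) from hGw w, decide_eq_true (show _ = k from hw)]; rfl
  · rw [show G w = bitE (decide ((decOQ w).2.2.2 = k)) from hGw w, decide_eq_false (show ¬ _ = k from hw)]; rfl

/-- ★ **Cor. 1.3's `hbits` from ℕ-valued gates and three `PSPACE` languages.** If `A n c`, `B n c : ℕ`
differ by the kernel entry (`A − B = kvKernelEntry n c` on `1 ≤ n`, `c < (n³+1)^{n²}` — the circuit's
designated gates `V⁺, V⁻`), and polynomial-time maps send the oracle code `⟨1ⁿ, ⟨c, ⟨j, s⟩⟩⟩` to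
queries answered by `PSPACE` languages for "bit `j` of `A ∸ B`", "bit `j` of `B ∸ A`" and "`A < B`",
then `coeffBitLanguage kvCanonicalFamily ∈ PSPACE` (Boolean closure of `PSPACE` through the tree's
`PSPACE`-complete language, `preimage_mem_PSPACE`, `bitSignQuery_natCast_sub_iff`,
`kernelEntryOracle_oracleLang`). [cite: KumarVolk2022, Cor. 1.3 (proof, §6)] [cite: AroraBarakCC2009, §4.2] -/
theorem coeffBitLanguage_kvCanonicalFamily_mem_PSPACE_of_gates {A B : ℕ → ℕ → ℕ}
    (hAB : ∀ n c : ℕ, 1 ≤ n → c < (n ^ 3 + 1) ^ (n * n) → (A n c : ℤ) - B n c = kvKernelEntry n c)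
    {L₁ L₂ L₃ : Language Bool} (hL₁ : L₁ ∈ PSPACE) (hL₂ : L₂ ∈ PSPACE) (hL₃ : L₃ ∈ PSPACE)
    {f₁ f₂ f₃ : List Bool → List Bool} (hf₁ : f₁ ∈ FP) (hf₂ : f₂ ∈ FP) (hf₃ : f₃ ∈ FP)
    (H₁ : ∀ n c j s : ℕ, 1 ≤ n → c < (n ^ 3 + 1) ^ (n * n) →
      (f₁ (oqE (n, c, j, s)) ∈ L₁ ↔ (A n c - B n c).testBit j = true))
    (H₂ : ∀ n c j s : ℕ, 1 ≤ n → c < (n ^ 3 + 1) ^ (n * n) →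
      (f₂ (oqE (n, c, j, s)) ∈ L₂ ↔ (B n c - A n c).testBit j = true))
    (H₃ : ∀ n c j s : ℕ, 1 ≤ n → c < (n ^ 3 + 1) ^ (n * n) →
      (f₃ (oqE (n, c, j, s)) ∈ L₃ ↔ A n c < B n c)) :
    coeffBitLanguage kvCanonicalFamily ∈ PSPACE := by
  obtain ⟨K, hK⟩ := exists_isComplete_PSPACE_holds
  -- the oracle, as a predicate on strings read through `decOQ`'s kind component
  let L : Language Bool :=
    {w | ((decOQ w).2.2.2 = 0 ∧ (f₁ w ∈ L₁ ∨ f₂ w ∈ L₂)) ∨ ((decOQ w).2.2.2 = 1 ∧ f₃ w ∈ L₃)}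
  have hLP : L ∈ PSPACE :=
    setOf_or_mem_PSPACE_of_complete hK
      (setOf_and_mem_PSPACE_of_complete hK (P_subset_PSPACE_holds (kindEq_mem_P 0))
        (setOf_or_mem_PSPACE_of_complete hK (preimage_mem_PSPACE hL₁ hf₁) (preimage_mem_PSPACE hL₂ hf₂)))
      (setOf_and_mem_PSPACE_of_complete hK (P_subset_PSPACE_holds (kindEq_mem_P 1))
        (preimage_mem_PSPACE hL₃ hf₃))
  have hLO : KernelEntryOracle L := fun n c j s hn hc => by
    show ((decOQ (oqE (n, c, j, s))).2.2.2 = 0 ∧ _ ∨ (decOQ (oqE (n, c, j, s))).2.2.2 = 1 ∧ _) ↔ _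
    rw [decOQ_oqE, ← hAB n c hn hc, bitSignQuery_natCast_sub_iff, H₁ n c j s hn hc, H₂ n c j s hn hc,
      H₃ n c j s hn hc, Bool.or_eq_true]
  exact coeffBitLanguage_kvCanonicalFamily_mem_PSPACE_of hLO hLP

/-- ★ **Kumar–Volk Cor. 1.3 from ℕ-valued gates and three `PSPACE` languages** (the closer's form).
[cite: KumarVolk2022, Cor. 1.3 (proof, §6)] -/
theorem kumarVolk2020_cor_1_3_of_gates {A B : ℕ → ℕ → ℕ}
    (hAB : ∀ n c : ℕ, 1 ≤ n → c < (n ^ 3 + 1) ^ (n * n) → (A n c : ℤ) - B n c = kvKernelEntry n c)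
    {L₁ L₂ L₃ : Language Bool} (hL₁ : L₁ ∈ PSPACE) (hL₂ : L₂ ∈ PSPACE) (hL₃ : L₃ ∈ PSPACE)
    {f₁ f₂ f₃ : List Bool → List Bool} (hf₁ : f₁ ∈ FP) (hf₂ : f₂ ∈ FP) (hf₃ : f₃ ∈ FP)
    (H₁ : ∀ n c j s : ℕ, 1 ≤ n → c < (n ^ 3 + 1) ^ (n * n) →
      (f₁ (oqE (n, c, j, s)) ∈ L₁ ↔ (A n c - B n c).testBit j = true))
    (H₂ : ∀ n c j s : ℕ, 1 ≤ n → c < (n ^ 3 + 1) ^ (n * n) →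
      (f₂ (oqE (n, c, j, s)) ∈ L₂ ↔ (B n c - A n c).testBit j = true))
    (H₃ : ∀ n c j s : ℕ, 1 ≤ n → c < (n ^ 3 + 1) ^ (n * n) →
      (f₃ (oqE (n, c, j, s)) ∈ L₃ ↔ A n c < B n c)) :
    kumarVolk2020_cor_1_3 :=
  kumarVolk2020_cor_1_3_of_canonicalBits
    (coeffBitLanguage_kvCanonicalFamily_mem_PSPACE_of_gates hAB hL₁ hL₂ hL₃ hf₁ hf₂ hf₃ H₁ H₂ H₃)

end Packaging

end UEval

end KumarVolk2020

end Literature.Computability.AlgebraicComplexity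

end
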